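/-
Copyright (c) 2026 the pub-hodgecm-mathlib formalisation cell (harness21).  Prover seat hodgecm-mathlib-F0P2-p10 (g4), Track B ∕ R90-TF, h413 = `stmt-HodgeConjecture-24833`,
R90-TF section S8 «ContSpec-n½», socket (E) :276, E1-PLANCHEREL BODY brick PB-1b-ii (S8 dealer R90-CS-plan (g4) S8-R254 (8)+(9); joint census `R90/S8/CENSUS-PlancherelBody-bricks.K2E1-p16-F0P2-p10.md` §PB-1):
the DIAGONAL BRACKET `[Ψ₁]_β` of the unfolded inner product of two twisted pseudo-Eisenstein series with the SAME unitary pair data on `U(2,1)_{L∕L⁺}` as a MELLIN LINE INTEGRAL —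
`[Ψ₁]_β = C · (2π)⁻¹ ∫_{Re z = σ₀} f̃(z)·conj f̃′(2 − z̄) dy · ⟪φ,φ′⟩_{K_U}` (sequel of ★ PB-1a p865168 and ★ PB-1b-i p865195; Tate's `d^×x` and Parseval at the `N = 3` weight `r^{−3}`).
-/
import Summits.HodgeConjecture.HodgeConjecture.Theorems.K2E1ChiPseudoEisensteinBracketOneIdeleCMThree   -- ★ PB-1b-i p865195 `integral_weight_smul_wOne_eq_setIntegral_ideleClass_cm_three` (brings ★ C4a, ★ (δ)₃, ★ C1, the U3 pair Defs)
import Summits.HodgeConjecture.HodgeConjecture.Theorems.K2E1IdeleClassRadialIntegralCM                  -- ★ C (GR) `setIntegral_comp_ideleNorm_eq` : `∫_𝓕 g(‖x‖) dν = V • ∫_0^∞ r⁻¹ • g r`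
import Summits.HodgeConjecture.HodgeConjecture.Theorems.K2E1MellinPaleyWienerHalfLine                    -- ★ A Parseval I `setIntegral_mul_conj_mul_cpow_eq` (weight `r^{−2}`), `continuous_ofReal_cpow_mul`
import HarnessLib

/-!
# PB-1b-ii — `K2E1ChiPseudoEisensteinBracketOneMellinCMThree`: THE DIAGONAL BRACKET `[Ψ₁]_β` AS A MELLIN LINE INTEGRAL (`N = 3` SHIFT `2 − z̄`)

Track B ∕ R90-TF, crux h413 = `stmt-HodgeConjecture-24833`, route of record `HCCMUnconditional`; cell `hodgecm-mathlib`, R90-TF programme, section S8 «ContSpec-n½», socket (E)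
(B ED. 7 :276): the E1-PLANCHEREL BODY (census-E4 row (5)) cut into bricks PB-1…PB-4 (S8-R254).  ★ PB-1a p865168 gives `⟨θ_{f,φ}, θ_{f′,φ′}⟩_X = c_μ·([Ψ₁]_β + [Ψ₂]_β)`,
★ PB-1b-i p865195 gives `[Ψ₁]_β = K·∫_{𝓕_I} (‖x‖‖x‖)⁻¹•(f(‖x‖)·conj f′(‖x‖)·⟪φ,φ′⟩_{K_U}) dν_I`; THIS FILE finishes the diagonal bracket: Tate's `d^×x = V·dr∕r` on the idele classes
and the Mellin–Parseval identity at the `N = 3` weight `r^{−3}`.  THEOREMS ONLY (no `def`, no `instance`, no notation, no named-fact hypothesis, no `sorry`; default heartbeats);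
lane `--supports stmt-HodgeConjecture-24833 --as helper` (count-neutral).  CLOSES NO SOCKET; the intertwined bracket `[Ψ₂]_β` (PB-1c) and the contour shift (PB-2) are untouched.

THE MATHEMATICS ([MoeglinWaldspurger1995] II.2.1; [TateThesis1967] §4.3; [Titchmarsh1948] Thm 71–72).
* §1 (pure analysis on `(0,∞)`, any `σ₀`): **`∫_0^∞ f(r)·conj g(r)·r^{−3} dr = (2π)⁻¹ ∫_ℝ mellin f (−z)·conj (mellin g (z̄ − 2)) dy`**, `z = σ₀ + iy`, for `f ∈ C²_c((0,∞))`,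
  `g ∈ C_c((0,∞))` — ★ A Parseval I (weight `r^{−2}`, shift `z̄ − 1`) applied to `g₁(r) := r^{−1}·g(r) ∈ C_c((0,∞))`, with `conj g₁(r)·r^{−2} = conj g(r)·r^{−3}` (`r > 0`) and
  `mellin g₁ s = mellin g (s − 1)` (Mathlib `mellin_cpow_smul`).  In MW's notation `f̃(z) = mellin f (−z)` this is `f̃(z)·conj f̃′(2 − z̄)`; on the unitary axis `Re z = 1` of `U(2,1)`
  (`ρ_P = 1` in the `H^z` convention; top residue `z = 2`, middle `z = 3∕2`) one has `2 − z̄ = z`, as it must.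
* §2 (any number field `K`): **`∫_𝓕 (‖x‖‖x‖)⁻¹•φ(‖x‖) dν = V•∫_0^∞ φ(r)·r^{−3} dr`** for an idele class domain `𝓕`, `V = idelicCovolume K ν` — ★ C `setIntegral_comp_ideleNorm_eq` with
  `g r = (r·r)⁻¹•φ r` and `r⁻¹•((r·r)⁻¹•φ r) = φ r·r^{−3}`; the `N = 3` twin of ★ C's head `setIntegral_inv_ideleNorm_smul_comp_eq` (`N = 2`, weight `r^{−2}`).
* §3 HEAD (CM, `N = 3`): ★ PB-1b-i ∘ §2 ∘ §1: one constant `C = K·V > 0` with **`∫ β•Ψ₁ dν_G = C·((2π)⁻¹∫_ℝ mellin f(−z)·conj(mellin f′(z̄ − 2)) dy)·∫_{K_U} φ·conj φ′ dμ_K`** for all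
  admissible data, `f ∈ C²_c((0,∞))`, `f′ ∈ C_c((0,∞))`, every `σ₀ ∈ ℝ`.

HONEST LABEL.  Pure bookkeeping of the diagonal (`w = 1`) bracket; nothing here touches `(E)`'s missing mathematics (PB-2's contour shift, PB-3a's Hecke action on sections).
HC_CM is proved only modulo the 7 printed citations (2 remaining named inputs: hLiu418 = `stmt-HodgeConjecture-24832`, h413 = `stmt-HodgeConjecture-24833`) until rung 0 closes;
this file pays nothing at the (E) socket; count-neutral.
-/

set_option autoImplicit false
set_option linter.dupNamespace false  -- the mandated namespace repeats the summit's segment (`HodgeConjecture.HodgeConjecture`)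

noncomputable section

open MeasureTheory Measure Set Filter Topology Complex NumberField IsDedekindDomain MulAction
open scoped Real NNReal ENNReal ComplexConjugate
open Literature.MeasureTheory.Group Literature.NumberTheory
open Literature.NumberTheory.Automorphic Literature.NumberTheory.Automorphic.UnitaryGroup AdelicGroupData
open Literature.NumberTheory.GaloisRepresentations (HeckeCharacter ideleGroup)
open Literature.NumberTheory.Automorphic.Arthur2013.Leaves.TECR
open Summit.HodgeConjecture.HodgeConjecture.Cruxes.H413.K2E1BorelEisensteinU
open Summit.HodgeConjecture.HodgeConjecture.Cruxes.H413.K2E1CharacterEisensteinU2Defs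
open Summit.HodgeConjecture.HodgeConjecture.Cruxes.H413.K2E1CharacterEisensteinU3PairDefs
open Summit.HodgeConjecture.HodgeConjecture.Cruxes.H413.K2E1MellinPaleyWienerHalfLine (setIntegral_mul_conj_mul_cpow_eq continuous_ofReal_cpow_mul)
open Summit.HodgeConjecture.HodgeConjecture.Cruxes.H413.K2E1IdeleClassRadialIntegralCM (setIntegral_comp_ideleNorm_eq)
open Summit.HodgeConjecture.HodgeConjecture.Cruxes.H413.K2E1ChiPseudoEisensteinBracketOneIdeleCMThree (integral_weight_smul_wOne_eq_setIntegral_ideleClass_cm_three)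

namespace Summit.HodgeConjecture.HodgeConjecture.Cruxes.H413.K2E1ChiPseudoEisensteinBracketOneMellinCMThree

/-! ## §1 Parseval at the `N = 3` weight `r^{−3}` (pure analysis on `(0,∞)`) -/

section Parseval

variable {f g : ℝ → ℂ}

/-- `r⁻¹ · r^{−2} = r^{−3}` for `r > 0` (complex powers with real positive base). [folklore] -/
theorem inv_mul_cpow_neg_two_eq {r : ℝ} (hr : 0 < r) : (r : ℂ)⁻¹ * (r : ℂ) ^ (-2 : ℂ) = (r : ℂ) ^ (-3 : ℂ) := by
  have hr0 : (r : ℂ) ≠ 0 := Complex.ofReal_ne_zero.2 hr.ne'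
  rw [Complex.cpow_neg, Complex.cpow_neg, show (2 : ℂ) = ((2 : ℕ) : ℂ) by norm_num, show (3 : ℂ) = ((3 : ℕ) : ℂ) by norm_num, Complex.cpow_natCast,
    Complex.cpow_natCast, ← mul_inv, ← pow_succ']

/-- For `r > 0`: `conj (r^{−1}·g r)·r^{−2} = conj (g r)·r^{−3}` inside the pairing, i.e.
`f r · conj ((r:ℂ)^{−1} · g r) · r^{−2} = f r · conj (g r) · r^{−3}`. [folklore] -/
theorem mul_conj_cpow_neg_one_mul_mul_cpow_neg_two_eq (f g : ℝ → ℂ) {r : ℝ} (hr : 0 < r) :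
    f r * conj ((r : ℂ) ^ (-1 : ℂ) * g r) * (r : ℂ) ^ (-2 : ℂ) = f r * conj (g r) * (r : ℂ) ^ (-3 : ℂ) := by
  rw [Complex.cpow_neg_one, map_mul, map_inv₀, Complex.conj_ofReal, ← inv_mul_cpow_neg_two_eq hr]
  ring

/-- The Mellin transform of `r ↦ r^{−1}·g(r)` is the shifted transform: `mellin (r ↦ (r:ℂ)^{−1}·g r) s = mellin g (s − 1)` (Mathlib `mellin_cpow_smul`). [folklore] -/
theorem mellin_cpow_neg_one_mul (g : ℝ → ℂ) (s : ℂ) : mellin (fun t : ℝ => (t : ℂ) ^ (-1 : ℂ) * g t) s = mellin g (s - 1) := by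
  rw [show (fun t : ℝ => (t : ℂ) ^ (-1 : ℂ) * g t) = fun t : ℝ => (t : ℂ) ^ (-1 : ℂ) • g t from rfl, mellin_cpow_smul, sub_eq_add_neg]

/-- **PARSEVAL AT THE `N = 3` WEIGHT** (the `w = 1` term of MW II.2.1 for `U(2,1)`): for `f ∈ C²_c((0,∞))`, `g ∈ C_c((0,∞))` and any `σ₀`,
**`∫_0^∞ f(r)·conj g(r)·r^{−3} dr = (2π)⁻¹ ∫_ℝ mellin f (−z)·conj (mellin g (z̄ − 2)) dy`**, `z = σ₀ + iy` — ★ A Parseval I (`K2E1MellinPaleyWienerHalfLine.setIntegral_mul_conj_mul_cpow_eq`,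
weight `r^{−2}`, shift `z̄ − 1`) applied to `g₁ = r^{−1}·g ∈ C_c((0,∞))` (★ `continuous_ofReal_cpow_mul`), then `mellin g₁ (z̄ − 1) = mellin g (z̄ − 2)`.  In MW's notation (`f̃(z) = mellin f (−z)`)
the right side is `(2π)⁻¹∫ f̃(z)·conj f̃′(2 − z̄) dy`; on the unitary axis `Re z = 1`, `2 − z̄ = z`. [cite: MoeglinWaldspurger1995, II.2.1] [cite: Titchmarsh1948, Thm 71–72] -/
theorem setIntegral_mul_conj_mul_cpow_neg_three_eq (hf : ContDiff ℝ 2 f) (hfs : HasCompactSupport f) (hf0 : tsupport f ⊆ Ioi 0)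
    (hgc : Continuous g) (hgs : HasCompactSupport g) (hg0 : tsupport g ⊆ Ioi 0) (σ₀ : ℝ) :
    ∫ r in Ioi (0 : ℝ), f r * conj (g r) * (r : ℂ) ^ (-3 : ℂ) =
      (((2 * π)⁻¹ : ℝ) : ℂ) * ∫ y : ℝ, mellin f (-((σ₀ : ℂ) + y * I)) * conj (mellin g (conj ((σ₀ : ℂ) + y * I) - 2)) := by
  -- the shifted profile `g₁ = r^{−1}·g ∈ C_c((0,∞))`
  have hg₁c : Continuous fun t : ℝ => (t : ℂ) ^ (-1 : ℂ) * g t := continuous_ofReal_cpow_mul hgc hg0 (-1)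
  have hg₁s : HasCompactSupport fun t : ℝ => (t : ℂ) ^ (-1 : ℂ) * g t := hgs.mul_left
  have hg₁0 : (tsupport fun t : ℝ => (t : ℂ) ^ (-1 : ℂ) * g t) ⊆ Ioi 0 := tsupport_mul_subset_right.trans hg0
  have h := setIntegral_mul_conj_mul_cpow_eq hf hfs hf0 hg₁c hg₁s hg₁0 σ₀
  simp only [mellin_cpow_neg_one_mul] at h
  rw [← setIntegral_congr_fun measurableSet_Ioi fun r hr => mul_conj_cpow_neg_one_mul_mul_cpow_neg_two_eq f g hr, h]
  congr 2 with y
  congr 3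
  ring

end Parseval

/-! ## §2 Tate's `d^×x` at the `N = 3` weight `(‖x‖‖x‖)⁻¹` (any number field) -/

section Tate

variable {K : Type} [Field K] [NumberField K]
variable [MeasurableSpace (GaloisRepresentations.ideleGroup K)] [BorelSpace (GaloisRepresentations.ideleGroup K)]

/-- `r⁻¹ • ((r·r)⁻¹ • φ r) = φ r · r^{−3}` for `r > 0` (real scalars acting on `ℂ`; complex power with real positive base). [folklore] -/
theorem inv_smul_mul_inv_smul_eq_mul_cpow_neg_three (φ : ℝ → ℂ) {r : ℝ} (hr : 0 < r) : r⁻¹ • ((r * r)⁻¹ • φ r) = φ r * (r : ℂ) ^ (-3 : ℂ) := by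
  have hr0 : (r : ℂ) ≠ 0 := Complex.ofReal_ne_zero.2 hr.ne'
  rw [smul_smul, Complex.real_smul, mul_comm, Complex.cpow_neg, show (3 : ℂ) = ((3 : ℕ) : ℂ) by norm_num, Complex.cpow_natCast]
  push_cast
  ring

/-- **`∫_𝓕 (‖x‖‖x‖)⁻¹ • φ(‖x‖) dν(x) = V • ∫_0^∞ φ(r)·r^{−3} dr`** for an idele class domain `𝓕` (★ `IsIdeleClassDomain`), a left-invariant `ν` finite on compacta (e.g. a Haar measure `ν_I`)
and `φ : ℝ → ℂ` with `u ↦ φ(e^u)` a.e.-strongly measurable; `V = idelicCovolume K ν`.  The `N = 3` twin of ★ C's head `K2E1IdeleClassRadialIntegralCM.setIntegral_inv_ideleNorm_smul_comp_eq`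
(`N = 2`, weight `‖x‖⁻¹`, `r^{−2}`): ★ C `setIntegral_comp_ideleNorm_eq` with `g r = (r·r)⁻¹ • φ r`.  Left side = the idele-class side of ★ PB-1b-i ∕ ★ (δ)₃; right side = the weight of §1.
[cite: CasselsFrohlichANT1967, Ch. XV §4.3–4.4] [cite: MoeglinWaldspurger1995, II.2.1] -/
theorem setIntegral_mul_inv_ideleNorm_smul_comp_eq (ν : Measure (GaloisRepresentations.ideleGroup K)) [ν.IsMulLeftInvariant] [IsFiniteMeasureOnCompacts ν]
    {𝓕 : Set (GaloisRepresentations.ideleGroup K)} (h𝓕 : IsIdeleClassDomain K 𝓕)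
    {φ : ℝ → ℂ} (hφ : AEStronglyMeasurable (fun u : ℝ => φ (Real.exp u)) volume) :
    ∫ x in 𝓕, ((IdeleClassGroup.ideleNorm K x : ℝ) * (IdeleClassGroup.ideleNorm K x : ℝ))⁻¹ • φ (IdeleClassGroup.ideleNorm K x : ℝ) ∂ν =
      (idelicCovolume K ν).toReal • ∫ r in Ioi (0 : ℝ), φ r * (r : ℂ) ^ (-3 : ℂ) := by
  have hg : AEStronglyMeasurable (fun u : ℝ => (Real.exp u * Real.exp u)⁻¹ • φ (Real.exp u)) volume :=
    ((Real.continuous_exp.mul Real.continuous_exp).inv₀ fun u => (mul_pos (Real.exp_pos u) (Real.exp_pos u)).ne').aestronglyMeasurable.smul hφ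
  rw [setIntegral_comp_ideleNorm_eq ν (h𝓕.isFundamentalDomain ν) (g := fun r : ℝ => (r * r)⁻¹ • φ r) hg]
  congr 1
  refine setIntegral_congr_fun measurableSet_Ioi fun r hr => ?_
  exact inv_smul_mul_inv_smul_eq_mul_cpow_neg_three φ hr

end Tate

/-! ## §3 HEAD: the diagonal bracket `[Ψ₁]_β` on `U(2,1)_{L∕L⁺}` as a Mellin line integral -/

section Head

variable (L : Type) [Field L] [NumberField L] [IsCMField L]
variable [MeasurableSpace (quasiSplit (↥(maximalRealSubfield L)) L (IsCMField.complexConj L) 3).Adelic] [BorelSpace (quasiSplit (↥(maximalRealSubfield L)) L (IsCMField.complexConj L) 3).Adelic]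
variable [MeasurableSpace (AdeleRing (𝓞 L) L)ˣ] [BorelSpace (AdeleRing (𝓞 L) L)ˣ]

/-- **PB-1b-ii — THE DIAGONAL BRACKET AS A MELLIN LINE INTEGRAL.**  Structural data: Haar `ν_G` on `G(𝔸)`, `μ_K` on `K_U`, `ν_I` on `𝕀_L` with an idele class domain `𝓕_I`.  There is ONE
`C > 0` (`= K·V`: ★ (δ)₃'s constant times the idelic covolume) such that for every covering weight `β` of `B(L⁺)♯`, every UNITARY Hecke character `χ₁`, AUTOMORPHIC `U(1)`-character `χ₂`,
continuous bounded pair sections `φ, φ′ ∈ (χ₁,χ₂)`, `f ∈ C²_c((0,∞))`, `f′ ∈ C_c((0,∞))` and EVERY `σ₀ ∈ ℝ` (`z = σ₀ + iy`): `β•Ψ₁ ∈ L¹(ν_G)` (`Ψ₁ = (f∘H)φ·conj((f′∘H)φ′)`) and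
**`∫ β•Ψ₁ dν_G = C · ((2π)⁻¹ ∫_ℝ mellin f (−z)·conj (mellin f′ (z̄ − 2)) dy) · ∫_{K_U} φ·conj φ′ dμ_K`** — ★ PB-1b-i (idele-class currency) ∘ §2 (Tate's `d^×x`, weight `r^{−3}`) ∘ §1
(Parseval at `r^{−3}`).  With ★ PB-1a p865168 this is the `w = 1` half of MW's inner-product formula II.2.1 for `θ_{f,φ}` on `U(2,1)`; the `w = w₀` half is PB-1c.
[cite: MoeglinWaldspurger1995, II.2.1] [cite: Rogawski1990, §7.3 (pp. 96–98)] [cite: TateThesis1967, §4.3] [cite: Titchmarsh1948, Thm 71–72] -/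
theorem integral_weight_smul_wOne_eq_mellin_cm_three
    (νG : Measure (quasiSplit (↥(maximalRealSubfield L)) L (IsCMField.complexConj L) 3).Adelic) [νG.IsHaarMeasure] (μK : Measure ((standardMaximalCompactGL 3 L).comap (adelicVal (↥(maximalRealSubfield L)) L (IsCMField.complexConj L) 3 ((StdForm.antidiagonal 3).over L)) : Subgroup (quasiSplit (↥(maximalRealSubfield L)) L (IsCMField.complexConj L) 3).Adelic)) [μK.IsHaarMeasure] (νI : Measure (AdeleRing (𝓞 L) L)ˣ) [νI.IsHaarMeasure]
    {𝓕I : Set (AdeleRing (𝓞 L) L)ˣ} (h𝓕I : IsIdeleClassDomain L 𝓕I) :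
    ∃ C : ℝ, 0 < C ∧
      ∀ {β : (quasiSplit (↥(maximalRealSubfield L)) L (IsCMField.complexConj L) 3).Adelic → ℝ≥0∞}, IsCoveringWeight ((arithmeticBorel (↥(maximalRealSubfield L)) L (IsCMField.complexConj L) 3).map (quasiSplit (↥(maximalRealSubfield L)) L (IsCMField.complexConj L) 3).arithmeticSubgroup.subtype) β →
      ∀ {χ₁ : HeckeCharacter L} {χ₂ : ↥(TorusDict.torus (IsCMField.complexConj L)) →ₜ* ℂˣ} {φ φ' : (quasiSplit (↥(maximalRealSubfield L)) L (IsCMField.complexConj L) 3).Adelic → ℂ},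
        χ₁.IsUnitary → TorusDict.IsAutomorphic (IsCMField.complexConj L) χ₂ →
        IsChiSectionPair χ₁ χ₂ φ → Continuous φ → ∀ {Cφ : ℝ}, (∀ x, ‖φ x‖ ≤ Cφ) →
        IsChiSectionPair χ₁ χ₂ φ' → Continuous φ' → ∀ {Cφ' : ℝ}, (∀ x, ‖φ' x‖ ≤ Cφ') →
      ∀ {f f' : ℝ → ℂ}, ContDiff ℝ 2 f → HasCompactSupport f → tsupport f ⊆ Ioi 0 → Continuous f' → HasCompactSupport f' → tsupport f' ⊆ Ioi 0 →
      ∀ σ₀ : ℝ,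
        Integrable (fun g : (quasiSplit (↥(maximalRealSubfield L)) L (IsCMField.complexConj L) 3).Adelic => (β g).toReal • (f (borelHeight g : ℝ) * φ g * conj (f' (borelHeight g : ℝ) * φ' g))) νG ∧
        ∫ g : (quasiSplit (↥(maximalRealSubfield L)) L (IsCMField.complexConj L) 3).Adelic, (β g).toReal • (f (borelHeight g : ℝ) * φ g * conj (f' (borelHeight g : ℝ) * φ' g)) ∂νG =
          (C : ℂ) * (((((2 * π)⁻¹ : ℝ) : ℂ) * ∫ y : ℝ, mellin f (-((σ₀ : ℂ) + y * I)) * conj (mellin f' (conj ((σ₀ : ℂ) + y * I) - 2))) *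
            ∫ k : ((standardMaximalCompactGL 3 L).comap (adelicVal (↥(maximalRealSubfield L)) L (IsCMField.complexConj L) 3 ((StdForm.antidiagonal 3).over L)) : Subgroup (quasiSplit (↥(maximalRealSubfield L)) L (IsCMField.complexConj L) 3).Adelic), φ (k : (quasiSplit (↥(maximalRealSubfield L)) L (IsCMField.complexConj L) 3).Adelic) * conj (φ' (k : (quasiSplit (↥(maximalRealSubfield L)) L (IsCMField.complexConj L) 3).Adelic)) ∂μK) := by
  haveI := t2Space_adeleRing_of_numberField L
  haveI := locallyCompactSpace_adeleRing' L
  obtain ⟨K, hK0, hKt, hH⟩ := integral_weight_smul_wOne_eq_setIntegral_ideleClass_cm_three L νG μK νI h𝓕I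
  have hV0 : idelicCovolume L νI ≠ 0 := idelicCovolume_ne_zero νI
  have hVt : idelicCovolume L νI ≠ ∞ := idelicCovolume_ne_top νI
  refine ⟨K.toReal * (idelicCovolume L νI).toReal, mul_pos (ENNReal.toReal_pos hK0 hKt) (ENNReal.toReal_pos hV0 hVt), ?_⟩
  intro β hβ χ₁ χ₂ φ φ' hχ₁u hχ₂ hφ hφc Cφ hφC hφ' hφ'c Cφ' hφ'C f f' hf hfs hf0 hf'c hf's hf'0 σ₀
  obtain ⟨hInt, -, hEq⟩ := hH hβ hχ₁u hχ₂ hφ hφc hφC hφ' hφ'c hφ'C hf.continuous hfs hf0 hf'c hf's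
  refine ⟨hInt, ?_⟩
  -- Tate's `d^×x` on `𝓕_I`, then Parseval at `r^{−3}`
  have hI : ∫ x in 𝓕I, ((IdeleClassGroup.ideleNorm L x : ℝ) * (IdeleClassGroup.ideleNorm L x : ℝ))⁻¹ • (f (IdeleClassGroup.ideleNorm L x : ℝ) * conj (f' (IdeleClassGroup.ideleNorm L x : ℝ)) * ∫ k : ((standardMaximalCompactGL 3 L).comap (adelicVal (↥(maximalRealSubfield L)) L (IsCMField.complexConj L) 3 ((StdForm.antidiagonal 3).over L)) : Subgroup (quasiSplit (↥(maximalRealSubfield L)) L (IsCMField.complexConj L) 3).Adelic), φ (k : (quasiSplit (↥(maximalRealSubfield L)) L (IsCMField.complexConj L) 3).Adelic) * conj (φ' (k : (quasiSplit (↥(maximalRealSubfield L)) L (IsCMField.complexConj L) 3).Adelic)) ∂μK) ∂νI =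
      ((idelicCovolume L νI).toReal : ℂ) * (((((2 * π)⁻¹ : ℝ) : ℂ) * ∫ y : ℝ, mellin f (-((σ₀ : ℂ) + y * I)) * conj (mellin f' (conj ((σ₀ : ℂ) + y * I) - 2))) *
        ∫ k : ((standardMaximalCompactGL 3 L).comap (adelicVal (↥(maximalRealSubfield L)) L (IsCMField.complexConj L) 3 ((StdForm.antidiagonal 3).over L)) : Subgroup (quasiSplit (↥(maximalRealSubfield L)) L (IsCMField.complexConj L) 3).Adelic), φ (k : (quasiSplit (↥(maximalRealSubfield L)) L (IsCMField.complexConj L) 3).Adelic) * conj (φ' (k : (quasiSplit (↥(maximalRealSubfield L)) L (IsCMField.complexConj L) 3).Adelic)) ∂μK) := by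
    rw [setIntegral_mul_inv_ideleNorm_smul_comp_eq νI h𝓕I (φ := fun r : ℝ => f r * conj (f' r) * ∫ k : ((standardMaximalCompactGL 3 L).comap (adelicVal (↥(maximalRealSubfield L)) L (IsCMField.complexConj L) 3 ((StdForm.antidiagonal 3).over L)) : Subgroup (quasiSplit (↥(maximalRealSubfield L)) L (IsCMField.complexConj L) 3).Adelic), φ (k : (quasiSplit (↥(maximalRealSubfield L)) L (IsCMField.complexConj L) 3).Adelic) * conj (φ' (k : (quasiSplit (↥(maximalRealSubfield L)) L (IsCMField.complexConj L) 3).Adelic)) ∂μK)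
      (((hf.continuous.mul (continuous_conj.comp hf'c)).comp Real.continuous_exp).mul continuous_const).aestronglyMeasurable,
      Complex.real_smul, ← setIntegral_mul_conj_mul_cpow_neg_three_eq hf hfs hf0 hf'c hf's hf'0 σ₀, ← integral_mul_const]
    congr 1
    refine setIntegral_congr_fun measurableSet_Ioi fun r _ => ?_
    ring
  rw [hEq, hI]
  push_cast
  ring

end Head

end Summit.HodgeConjecture.HodgeConjecture.Cruxes.H413.K2E1ChiPseudoEisensteinBracketOneMellinCMThree

end
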